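import Mathlib

/-!
# `LieRankDesigns` (stmt-MatrixMultiplication-7614), line `Sketch`: the Siegel-triangle matching identities

Helper lemmas for the design stub G/G' (card `Cruxes/LieRankDesigns/Ideas/siegel-triangle-elliptic-twist.md`, its
"First lemma" `triangle_matching_levi_descent` — registered on the crux as stub `stub_triangleLeviDescent` — and `triangle_radicals_tpp`).  In `GL_{2k}` with the three pairwise
complementary `k`-spaces `E₁ = (∗,0)`, `E₂ = (0,∗)`, `E₃ = graph φ`, put `x(a,c) = [[a,0],[c,1]] ∈ Stab(E₂)`,
`z(b,d) = [[1,b],[0,d]] ∈ Stab(E₁)` and `y(b',d') = T_φ [[1,b'],[0,d']] T_φ⁻¹ = [[1-b'φ, b'],[φ-φb'φ-d'φ, φb'+d']]`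
(`T_φ = [[1,0],[φ,1]]`).  TPP-EXACTNESS: `y(b',d') = x(a,c)·z(b,d)` forces `a = 1 - b'φ`, `ab = b'`, `c = φa - d'φ`
and `dφa = d'φ` — so the TPP of Levi-decorated triangle pieces descends to `GL_k` — and for the pure radicals
(`a = d = d' = 1`) it forces `b = b' = c = 0` once `φ` is a unit (the radical triangle has the TPP).  Pure block-matrix
algebra over any commutative ring; no primality needed.
-/

set_option linter.dupNamespace false

namespace Summit.MatrixMultiplication.MatrixMultiplication.Theorems.LieRankDesigns

open Matrix

/-- **Levi descent of the triangle matching equations** (card siegel-triangle-elliptic-twist, identity I1): if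
`y(b',d') = x(a,c)·z(b,d)` as `2k × 2k` block matrices then `a = 1 - b'φ`, `ab = b'`, `c = φa - d'φ` and
`dφa = d'φ`.  (From the `(1,1)` and `(1,2)` blocks `a(1 + bφ) = 1`, hence `(1 + bφ)a = 1`; the `(2,2)` block then
gives `d = d'(1 + φb)` and `dφa = d'φ(a + bφa) = d'φ`.) -/
theorem stub_triangleLeviDescent :
    ∀ (k : ℕ) (R : Type) [CommRing R] (φ a b c d b' d' : Matrix (Fin k) (Fin k) R),
      Matrix.fromBlocks (1 - b' * φ) b' (φ - φ * b' * φ - d' * φ) (φ * b' + d') =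
        Matrix.fromBlocks a 0 c 1 * Matrix.fromBlocks 1 b 0 d →
      a = 1 - b' * φ ∧ a * b = b' ∧ c = φ * a - d' * φ ∧ d * φ * a = d' * φ := by
  intro k R _ φ a b c d b' d' h
  rw [Matrix.fromBlocks_multiply] at h
  simp only [Matrix.mul_one, Matrix.zero_mul, add_zero, Matrix.one_mul, Matrix.mul_zero] at h
  obtain ⟨h11, h12, h21, h22⟩ := Matrix.fromBlocks_inj.1 h
  -- h11 : 1 - b' * φ = a, h12 : b' = a * b, h21 : φ - φ * b' * φ - d' * φ = c, h22 : φ * b' + d' = c * b + d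
  have ha : a = 1 - b' * φ := h11.symm
  have hab : a * b = b' := h12.symm
  have hc : c = φ * a - d' * φ := by
    rw [← h21, ha]; noncomm_ring
  -- a (1 + b φ) = 1, hence (1 + b φ) a = 1
  have hinv : a * (1 + b * φ) = 1 := by
    rw [mul_add, mul_one, ← mul_assoc, hab, ha]; noncomm_ring
  have hinv' : (1 + b * φ) * a = 1 := mul_eq_one_comm.1 hinv
  -- d = d' (1 + φ b)
  have hd : d = d' * (1 + φ * b) := by
    have h22' : d = φ * b' + d' - c * b := by rw [h22]; abel
    rw [h22', hc, sub_mul, mul_assoc φ a b, hab]; noncomm_ring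
  refine ⟨ha, hab, hc, ?_⟩
  calc d * φ * a = d' * φ * ((1 + b * φ) * a) := by rw [hd]; noncomm_ring
    _ = d' * φ := by rw [hinv', mul_one]

/-- **The radical triangle has the TPP** (card, `triangle_radicals_tpp`): with `a = d = d' = 1` the matching
equations force `b' = 0`, `b = 0`, `c = 0` as soon as `φ` is a unit: `1 = 1 - b'φ` gives `b'φ = 0`, so `b' = 0`,
then `b = ab = b' = 0` and `c = φ - d'φ = 0`. -/
theorem triangle_radicals_tpp {k : ℕ} {R : Type} [CommRing R] (φ b c b' : Matrix (Fin k) (Fin k) R)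
    (hφ : IsUnit φ)
    (h : Matrix.fromBlocks (1 - b' * φ) b' (φ - φ * b' * φ - 1 * φ) (φ * b' + 1) =
      Matrix.fromBlocks 1 0 c 1 * Matrix.fromBlocks 1 b 0 1) :
    b = 0 ∧ b' = 0 ∧ c = 0 := by
  obtain ⟨ha, hab, hc, -⟩ := stub_triangleLeviDescent k R φ 1 b c 1 b' 1 h
  have hb'φ : b' * φ = 0 := by
    have := congrArg (fun M => 1 - M) ha
    simpa using this.symm
  have hb' : b' = 0 := by
    obtain ⟨u, hu⟩ := hφ
    have := congrArg (fun M => M * (↑u⁻¹ : Matrix (Fin k) (Fin k) R)) hb'φ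
    simpa [mul_assoc, ← hu] using this
  refine ⟨?_, hb', ?_⟩
  · rw [one_mul] at hab; rw [hab, hb']
  · rw [hc]; simp

end Summit.MatrixMultiplication.MatrixMultiplication.Theorems.LieRankDesigns
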